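import Summits.QuantumFields.YangMills.Theorems.UnitScaleTiltFluctuationComparisonRegPrRepAtHeightsDataT3c
import HarnessLib

/-!
# Route `UnitScaleTilt` — crux `FluctuationComparisonRegPrL` (stmt-QuantumFields-19935), v5h STUB 3′ `stub_alphaTwoRunOfLane`, conjunct (A)
# `RepAtHeights`: THE LOWER ONE-STEP TRIVIAL ENVELOPE OF THE LANE'S DATUM `OfV2At.dataT3c` FROM THE v2 (α) ROWS — the residual row
# `Bound55AC.Fibre57LowAC` IS the frame's lower one-step envelope (support file `--supports stmt-QuantumFields-19935`; the stub stays open)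

Fleet seat `ym-ust-19201-p2` (gen 3, socket pen); split card `CARD-19935-STUB3prime-split.md` (evidence #18 on the item), finding F-g3-1 §1 row «(A.iii)
lower half»; continues `…RepAtHeightsDataT3c` (p502074: conjunct (A) at the datum modulo the two one-step rows).
WHAT THIS FILE PROVES.  §1 (abstract carrier `B10.TowerRun`, bookkeeping re-derived from [Balaban1985UV3] p.272 «the lower bound is proved in the same
way, with all simplifications coming from the fact that Ω_{k+1} = T_η»): the EXPONENT form of LQB's `B10SectAGathering.ineq47_succ_of_leaves` at the trivial
history — from the lower step leaves (`CumulantLower`, `Repr33_60`, `VacuumWhole`, `Decomp35_61`, `Norm35`, `StarCount`, `OldOutside`, `PintSucc`, `Estep62`,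
`RmSucc`) the (47)-exponent of level `k+1` is BELOW the one-step piece exponent (57) (`ineq47_exponent_succ_le`, `…_of_leaves`).  §2 (the lane's datum):
**`OfV2At.dataT3c_oneStepLowerTrivAt`** — for every run `K` and step `k < K`, `OneStepLowerTrivAt (dataT3c …) 𝔠.b₀ 𝔠.p₀ K k`: the (α) step row
`Fibre57LowAC` (R3D-02, «χ_{k+1}·e^{(57)-exponent at triv} ≤ T_k[χ_k·e^{(47)_k-exponent at triv}]» dV-a.e.) + §1's gathering over the fourteen step leaves the
lane derives from `RunAlphaAC` (`Thm2AC.stepResidualsAC_of_alpha`, `stepLeavesOfAC`) + the route normalisation `Ecst K j = E_j − E` carried through the transport by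
homogeneity (`rnTransport_const_mul_ae`) + the window dictionary `χ_j = 𝟙[PlaqSmall θBal(K−j)]` (`dataT3c_chi_eq`).  §3 **`OfV2At.repAtHeights_dataT3c_of_upperRows`**:
conjunct (A) at the datum MODULO THE UPPER ONE-STEP ROWS ALONE (`OneStepUpperTrivAt`, = `Fibre49AC` at the trivial history + exact Haar compatibility
`HaarCompatT3 F` — the ONE located leaf of finding F-g3-1) and the adapter's thresholds.  CONDITIONAL on the v2 package `OfV2At F 𝔠 a₀ a₁`; nothing of
Bałaban's analysis is asserted; standard axioms.

References: T. Bałaban, CMP 102 (1985) 255–275 [Balaban1985UV3] ((36)–(37) p.265, (41) p.266, (47) p.267, (55)–(62) pp.269–271, p.272 L28–33).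
-/

set_option autoImplicit false

noncomputable section

namespace Summit.QuantumFields.YangMills.Theorems

open MeasureTheory Filter
open Literature.MathematicalPhysics.QuantumFieldTheory.Balaban1983to89
open Literature.MathematicalPhysics.QuantumFieldTheory.Balaban1983to89.B10
open Literature.MathematicalPhysics.QuantumFieldTheory.Balaban1983to89.B10SectAGathering
open Literature.MathematicalPhysics.QuantumFieldTheory.Balaban1983to89.AveragingRT (rnTransport)
open Literature.MathematicalPhysics.QuantumFieldTheory.Balaban1983to89.T3ContinuumYM3Torus
open Literature.MathematicalPhysics.QuantumFieldTheory.Balaban1983to89.T3UnitLawDensityEML (ℰp rt)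
open Literature.MathematicalPhysics.QuantumFieldTheory.Balaban1983to89.T3UnitScaleTilt (θBal)
open Literature.MathematicalPhysics.QuantumFieldTheory.Balaban1983to89.T3LevelShift (fieldShift)
open Literature.MathematicalPhysics.QuantumFieldTheory.Balaban1983to89.T3PrintedRegularMinimiser
open Literature.MathematicalPhysics.QuantumFieldTheory.Balaban1983to89.T3AlphaInputsAC
open Literature.MathematicalPhysics.QuantumFieldTheory.Balaban1983to89.T3AlphaInputsACTrivEnvelope
open Literature.MathematicalPhysics.QuantumFieldTheory.Balaban1985CMP102
open Literature.MathematicalPhysics.QuantumFieldTheory.Balaban1985CMP102.Setting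
open Summit.QuantumFields.Balaban3D.Carriers
open Summit.QuantumFields.Balaban3D.Proofs.Primitives
open Summit.QuantumFields.Balaban3D.Proofs.TowerAC
open Summit.QuantumFields.Balaban3D.Proofs.StandardAC
open Summit.QuantumFields.Balaban3D.Proofs.InputsAC
open Summit.QuantumFields.Balaban3D.Proofs.Bound55AC
open Summit.QuantumFields.Balaban3D.Proofs.Thm2AC
open Summit.QuantumFields.YangMills.Theorems.LogComparisonRepAtHeights

/-! ## §1 The lower gathering at the trivial history, exponent form (abstract carrier) -/

namespace LogComparisonRepAtHeights

/-- **(37)/(47) GATHERING AT THE TRIVIAL HISTORY, EXPONENT FORM**: with `|Z_k| = 0` at the trivial history the vacuum, normalisation, star-count and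
old-term leaves collapse to equalities up to `rem`, and the lower cumulant / representation / decomposition leaves give
`−mainT_{k+1}(triv) + Pint_{k+1}(triv) − E_{k+1} − Rm_{k+1} ≤ −mainT_{k+1}(triv) − E_k + (log σ₀ + d(𝔤) log g_k)|B*| + log Z^{(k)} + P_old − Rm_k + log Fl`
pointwise — the arithmetic inside LQB's `ineq47_succ_of_leaves`, re-derived with the exponent as conclusion (p.272 «The lower bound is proved in the same
way, with all simplifications coming from the fact that Ω_{k+1} = T_η»). [cite: Balaban1985UV3, (37) p.265 and p.272] -/
theorem ineq47_exponent_succ_le {T : TowerRun} {k : ℕ} (P : StepPieces T k) {C₁ C₂ Cv C₃ C₄ C₅ c₁ C₆ : ℝ}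
    (hk : k + 1 ≤ T.K) (h58 : CumulantLower P C₁) (h60 : Repr33_60 P C₂) (hvac : VacuumWhole P Cv C₃)
    (h61 : Decomp35_61 P C₄) (h35 : Norm35 P C₅) (hstar : StarCount P c₁) (hold : OldOutside P C₆)
    (hPint : PintSucc P) (hE : Estep62 P) (hR : RmSucc P (C₁ + C₂ + C₃ + C₄)) (U : T.Cfg (k + 1)) :
    -(T.mainT (k + 1) (T.triv (k + 1)) U) + T.Pint (k + 1) (T.triv (k + 1)) U - T.Ecst (k + 1) - T.Rm (k + 1) ≤
      -(T.mainT (k + 1) (T.triv (k + 1)) U) - T.Ecst k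
        + (P.logσ₀ + P.dg * Real.log (T.g k)) * P.starB (T.triv (k + 1)) + P.logZU (T.triv (k + 1)) U
        + P.Pold (T.triv (k + 1)) U - T.Rm k + P.logFl (T.triv (k + 1)) U := by
  have hEcst : T.Ecst (k + 1) = T.Ecst k - T.Estep k := by
    rw [T.Ecst_eq, T.Ecst_eq, Finset.sum_eq_sum_Ico_succ_bot (by omega : k < T.K)]
    ring
  have hZ0 : P.Zvol (T.triv (k + 1)) = 0 := P.Zvol_triv
  have h58' := h58 U
  have h60' := abs_le.1 (h60 (T.triv (k + 1)) U)
  have hvac' := abs_le.1 (hvac (T.triv (k + 1)))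
  have h61' := abs_le.1 (h61 (T.triv (k + 1)) U)
  have h35' := abs_le.1 (h35 (T.triv (k + 1)))
  have hold' := abs_le.1 (hold (T.triv (k + 1)) U)
  obtain ⟨hs0, hs1⟩ := hstar (T.triv (k + 1))
  have hR' : T.Rm k + (C₁ + C₂ + C₃ + C₄) * P.rem ≤ T.Rm (k + 1) := hR
  rw [hZ0] at hvac' h35' hold' hs1
  rw [hPint (T.triv (k + 1)) U, hEcst, hE]
  have hstarEq : P.starB (T.triv (k + 1)) = P.starT := by
    have : P.starT - P.starB (T.triv (k + 1)) ≤ 0 := by simpa using hs1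
    linarith
  rw [hstarEq]
  nlinarith [h58', h60'.1, h60'.2, hvac'.1, hvac'.2, h61'.1, h61'.2, h35'.1, h35'.2, hold'.1, hold'.2, hR']

/-- The same from a bundle of step leaves (LQB `StepLeaves`; the remainder booking `max C₁ C₁′ + …` weakened to the lower one by `RmSucc.mono`).
[cite: Balaban1985UV3, (37) p.265 and p.272] -/
theorem ineq47_exponent_succ_le_of_leaves {T : TowerRun} {k : ℕ} (SL : StepLeaves T k) (hk : k + 1 ≤ T.K) (U : T.Cfg (k + 1)) :
    -(T.mainT (k + 1) (T.triv (k + 1)) U) + T.Pint (k + 1) (T.triv (k + 1)) U - T.Ecst (k + 1) - T.Rm (k + 1) ≤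
      -(T.mainT (k + 1) (T.triv (k + 1)) U) - T.Ecst k
        + (SL.P.logσ₀ + SL.P.dg * Real.log (T.g k)) * SL.P.starB (T.triv (k + 1)) + SL.P.logZU (T.triv (k + 1)) U
        + SL.P.Pold (T.triv (k + 1)) U - T.Rm k + SL.P.logFl (T.triv (k + 1)) U :=
  ineq47_exponent_succ_le SL.P hk SL.cumulantLower SL.repr33_60 SL.vacuumWhole SL.decomp35_61 SL.norm35 SL.starCount
    SL.oldOutside SL.pintSucc SL.estep62 (SL.rmSucc.mono (by have := le_max_right SL.C₁ SL.C₁'; linarith)) U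

end LogComparisonRepAtHeights

/-! ## §2 The lower one-step trivial envelope of the lane's datum from the (α) rows -/

section Lower

variable {F : T3Family} {𝔠 : AlphaConsts F.L (suGroupModel 2).N} {a₀ a₁ : ℝ}
  (h : AlphaInputsT3AC.OfV2At F 𝔠 a₀ a₁) (hc : 0 < a₀ ∧ 0 < a₁ ∧ 𝔠.B₃ * a₁ ≤ a₀) (γ : ℝ) (hγ : 0 < γ)
  (hγ1 : γ ≤ (min 𝔠.gamma0 1) ^ 2) (π : AlphaInputsT3AC.PolymerT3 F)

/-- The window dictionary as an indicator identity: `χ_j(U)·f(U) = 𝟙[PlaqSmall θBal(K−j)]·f` for the datum's characteristic function (`dataT3c_chi_eq`).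
[cite: Balaban1985UV3, (47) p.267] -/
theorem AlphaInputsT3AC.OfV2At.dataT3c_chi_mul_eq_indicator (K j : ℕ) (hj : j ≤ K)
    (f : GaugeField (F.P K) j (Matrix.specialUnitaryGroup (Fin 2) ℂ) → ℝ) (U : GaugeField (F.P K) j (Matrix.specialUnitaryGroup (Fin 2) ℂ)) :
    (h.dataT3c hc γ hγ hγ1 π).χ K j U * f U =
      {W' : GaugeField (F.P K) j (Matrix.specialUnitaryGroup (Fin 2) ℂ) | PlaqSmall (θBal F.L γ 𝔠.b₀ 𝔠.p₀ (K - j)) W'}.indicator f U := by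
  rw [h.dataT3c_chi_eq hc γ hγ hγ1 π K j hj U]
  unfold chiSmall
  by_cases hU : PlaqSmall (θBal F.L γ 𝔠.b₀ 𝔠.p₀ (K - j)) U
  · rw [if_pos (show PlaqSmallOn Set.univ (θBal F.L γ 𝔠.b₀ 𝔠.p₀ (K - j)) U from fun q _ => hU q), one_mul,
      Set.indicator_of_mem (show U ∈ {W' | PlaqSmall (θBal F.L γ 𝔠.b₀ 𝔠.p₀ (K - j)) W'} from hU)]
  · rw [if_neg (fun hs : PlaqSmallOn Set.univ (θBal F.L γ 𝔠.b₀ 𝔠.p₀ (K - j)) U => hU fun q => hs q (Set.mem_univ q)), zero_mul,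
      Set.indicator_of_notMem (show U ∉ {W' | PlaqSmall (θBal F.L γ 𝔠.b₀ 𝔠.p₀ (K - j)) W'} from hU)]

/-- On the window the datum's characteristic function is `1`. [cite: Balaban1985UV3, (47) p.267] -/
theorem AlphaInputsT3AC.OfV2At.dataT3c_chi_eq_one (K j : ℕ) (hj : j ≤ K) (U : GaugeField (F.P K) j (Matrix.specialUnitaryGroup (Fin 2) ℂ))
    (hU : PlaqSmall (θBal F.L γ 𝔠.b₀ 𝔠.p₀ (K - j)) U) : (h.dataT3c hc γ hγ hγ1 π).χ K j U = 1 := by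
  have e := h.dataT3c_chi_mul_eq_indicator hc γ hγ hγ1 π K j hj (fun _ => (1 : ℝ)) U
  rw [mul_one, Set.indicator_of_mem (show U ∈ {W' | PlaqSmall (θBal F.L γ 𝔠.b₀ 𝔠.p₀ (K - j)) W'} from hU)] at e
  exact e

/-- **THE LOWER ONE-STEP TRIVIAL ENVELOPE OF THE LANE'S DATUM — PROVED FROM THE (α) ROWS**: for every run `K` and step `k < K`,
`OneStepLowerTrivAt (dataT3c …) 𝔠.b₀ 𝔠.p₀ K k` — the v2 package's residual step row `Fibre57LowAC` (R3D-02) at step `k`, the lower gathering §1 over the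
lane's fourteen step leaves (`Thm2AC.stepResidualsAC_of_alpha` / `stepLeavesOfAC`), homogeneity of the transport for the route normalisation `e^{E}`, and the
window dictionary.  [Balaban1985UV3] p.265 L21–28 / p.272 L32–33 for the route's restricted densities. [cite: Balaban1985UV3, (37) p.265, (47) p.267 and p.272] -/
theorem AlphaInputsT3AC.OfV2At.dataT3c_oneStepLowerTrivAt (K k : ℕ) (hk : k + 1 ≤ K) :
    OneStepLowerTrivAt (h.dataT3c hc γ hγ hγ1 π) 𝔠.b₀ 𝔠.p₀ K k hk := by
  -- the package's data of run `K`, its (α) step row at `k`, the step leaves, the gathering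
  have hle := T3Scales_window F 𝔠 γ hγ hγ1 K
  have st := (h.pkgAtV2 hc γ hγ hγ1 K).run.steps k hk
  have R := stepResidualsAC_of_alpha hle k hk st
  have hgath := fun U => ineq47_exponent_succ_le_of_leaves (stepLeavesOfAC k hk R) hk U
  have h57 := st.fibre57Low
  have hint47 := hint47_stdAC (h.pkgAtV2 hc γ hγ hγ1 K).X 𝔠.lane.carrier (h.pkgAtV2 hc γ hγ hγ1 K).𝔖 (fun _ => True) k
    (st.hU _) (st.hPm _) ((h.pkgAtV2 hc γ hγ hγ1 K).𝔄.cP k) (st.hPb _)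
  -- abbreviations in the tower's letters
  set T : TowerRun := (h.pkgAtV2 hc γ hγ hγ1 K).T with hT
  set E : ℝ := (h.pkgAtV2 hc γ hγ hγ1 K).E with hE
  set P := piecesAC 𝔠.lane (h.pkgAtV2 hc γ hγ hγ1 K).X (h.pkgAtV2 hc γ hγ hγ1 K).𝔖 k with hP
  -- the integrand of the right side of `Fibre57LowAC` and its non-negativity
  set f : GaugeField (F.P K) k (Matrix.specialUnitaryGroup (Fin 2) ℂ) → ℝ := fun U =>
    T.χ k U * Real.exp (-(T.mainT k (T.triv k) U) + T.Pint k (T.triv k) U - T.Ecst k - T.Rm k) with hf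
  have hf0 : ∀ U, 0 ≤ f U := fun U => mul_nonneg (T.χ_nonneg k U) (Real.exp_pos _).le
  have hfi : Integrable f (fieldMeasure (F.P K) k (Matrix.specialUnitaryGroup (Fin 2) ℂ)) := hint47
  -- the transport of the route: `rt F K k` IS `rnTransport` over the pinned averaging `(p.X).av k = blockAvg ℰp`
  have hkm : k + 1 ≤ F.m + K := by omega
  have hav : ((h.pkgAtV2 hc γ hγ hγ1 K).X).av k = BlockAveraging.blockAvg (P := F.P K) (j := k) ℰp := avT3_of_le F K hkm
  have hrtT : ∀ g : GaugeField (F.P K) k (Matrix.specialUnitaryGroup (Fin 2) ℂ) → ℝ,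
      (rt F K k hkm).T g = rnTransport (((h.pkgAtV2 hc γ hγ hγ1 K).X).av k).avg g := fun g => by
    rw [hav]; rfl
  -- the restricted lower envelope of level `k` IS `e^{E}·f`
  have hind : {W' : GaugeField (F.P K) k (Matrix.specialUnitaryGroup (Fin 2) ℂ) | PlaqSmall (θBal F.L γ 𝔠.b₀ 𝔠.p₀ (K - k)) W'}.indicator
      (lowerTriv (h.dataT3c hc γ hγ hγ1 π) K k) = fun U => Real.exp E * f U := by
    funext U
    rw [← h.dataT3c_chi_mul_eq_indicator hc γ hγ hγ1 π K k (by omega) _ U, lowerTriv_eq_exp]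
    show T.χ k U * Real.exp ((-(T.mainT k (T.triv k) U) + T.Pint k (T.triv k) U - (T.Ecst k - E)) - T.Rm k) =
      Real.exp E * (T.χ k U * Real.exp (-(T.mainT k (T.triv k) U) + T.Pint k (T.triv k) U - T.Ecst k - T.Rm k))
    rw [show (-(T.mainT k (T.triv k) U) + T.Pint k (T.triv k) U - (T.Ecst k - E)) - T.Rm k =
        E + (-(T.mainT k (T.triv k) U) + T.Pint k (T.triv k) U - T.Ecst k - T.Rm k) by ring, Real.exp_add]
    ring
  -- homogeneity of the transport under the constant `e^{E}`
  have hhom := rnTransport_const_mul_ae (((h.pkgAtV2 hc γ hγ hγ1 K).X).av k).avg f hf0 hfi (Real.exp_nonneg E)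
  -- the goal
  show ∀ᵐ W ∂fieldMeasure (F.P K) (k + 1) (Matrix.specialUnitaryGroup (Fin 2) ℂ),
    PlaqSmall (θBal F.L γ 𝔠.b₀ 𝔠.p₀ (K - (k + 1))) W →
      lowerTriv (h.dataT3c hc γ hγ hγ1 π) K (k + 1) W ≤
        (rt F K k hkm).T ({W' : GaugeField (F.P K) k (Matrix.specialUnitaryGroup (Fin 2) ℂ) |
          PlaqSmall (θBal F.L γ 𝔠.b₀ 𝔠.p₀ (K - k)) W'}.indicator (lowerTriv (h.dataT3c hc γ hγ hγ1 π) K k)) W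
  rw [hind, hrtT]
  filter_upwards [h57, hhom] with W h57W hhomW
  intro hWs
  have hχ1 : T.χ (k + 1) W = 1 := h.dataT3c_chi_eq_one hc γ hγ hγ1 π K (k + 1) hk W hWs
  have hexp : lowerTriv (h.dataT3c hc γ hγ hγ1 π) K (k + 1) W =
      Real.exp E * Real.exp (-(T.mainT (k + 1) (T.triv (k + 1)) W) + T.Pint (k + 1) (T.triv (k + 1)) W - T.Ecst (k + 1) - T.Rm (k + 1)) := by
    rw [lowerTriv_eq_exp]
    show Real.exp ((-(T.mainT (k + 1) (T.triv (k + 1)) W) + T.Pint (k + 1) (T.triv (k + 1)) W - (T.Ecst (k + 1) - E)) - T.Rm (k + 1)) = _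
    rw [← Real.exp_add]
    congr 1
    ring
  have key : lowerTriv (h.dataT3c hc γ hγ hγ1 π) K (k + 1) W ≤ Real.exp E * rnTransport (((h.pkgAtV2 hc γ hγ hγ1 K).X).av k).avg f W := by
    rw [hexp]
    refine mul_le_mul_of_nonneg_left ?_ (Real.exp_nonneg E)
    calc Real.exp (-(T.mainT (k + 1) (T.triv (k + 1)) W) + T.Pint (k + 1) (T.triv (k + 1)) W - T.Ecst (k + 1) - T.Rm (k + 1))
        ≤ Real.exp (-(T.mainT (k + 1) (T.triv (k + 1)) W) - T.Ecst k
            + (P.logσ₀ + P.dg * Real.log (T.g k)) * P.starB (T.triv (k + 1)) + P.logZU (T.triv (k + 1)) W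
            + P.Pold (T.triv (k + 1)) W - T.Rm k + P.logFl (T.triv (k + 1)) W) := Real.exp_le_exp.mpr (hgath W)
      _ = T.χ (k + 1) W * Real.exp (-(T.mainT (k + 1) (T.triv (k + 1)) W) - T.Ecst k
            + (P.logσ₀ + P.dg * Real.log (T.g k)) * P.starB (T.triv (k + 1)) + P.logZU (T.triv (k + 1)) W
            + P.Pold (T.triv (k + 1)) W - T.Rm k + P.logFl (T.triv (k + 1)) W) := by rw [hχ1, one_mul]
      _ ≤ rnTransport (((h.pkgAtV2 hc γ hγ hγ1 K).X).av k).avg f W := h57W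
  exact key.trans (le_of_eq hhomW.symm)

end Lower

/-! ## §3 Conjunct (A) at the datum modulo the upper rows alone -/

section Assembly

variable {F : T3Family} {𝔠 : AlphaConsts F.L (suGroupModel 2).N} {a₀ a₁ : ℝ}
  (h : AlphaInputsT3AC.OfV2At F 𝔠 a₀ a₁) (hc : 0 < a₀ ∧ 0 < a₁ ∧ 𝔠.B₃ * a₁ ≤ a₀) (γ : ℝ) (hγ : 0 < γ)
  (hγ1 : γ ≤ (min 𝔠.gamma0 1) ^ 2) (π : AlphaInputsT3AC.PolymerT3 F)

/-- **`RepAtHeights` FOR THE LANE'S DATUM MODULO THE UPPER ONE-STEP ROWS ALONE**: conjunct (A) of v5h STUB 3′ at `D = OfV2At.dataT3c`, given the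
v2 (α) package at the record's constants, the adapter's thresholds, and — the ONE located leaf of finding F-g3-1 — the MASS-FREE upper one-step trivial
envelopes `OneStepUpperTrivAt D 𝔠.b₀ 𝔠.p₀ K j` (`Fibre49AC` at the trivial history + exact Haar compatibility `HaarCompatT3 F`).
[cite: Balaban1985UV3, (41) p.266 and (47) p.267; Balaban1985Variational, Thm 1 (8) p.279] -/
theorem AlphaInputsT3AC.OfV2At.repAtHeights_dataT3c_of_upperRows (ε₀ : ℝ) (hε : 0 < ε₀) (hhi : ε₀ ≤ a₀)
    (ha₁ : ∀ n, θBal F.L γ 𝔠.b₀ 𝔠.p₀ n ≤ a₁) (hlo : ∀ n, 𝔠.B₃ * θBal F.L γ 𝔠.b₀ 𝔠.p₀ n ≤ ε₀)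
    (h4 : ∀ n, 4 * θBal F.L γ 𝔠.b₀ 𝔠.p₀ n < ε₀)
    (hup : ∀ (K j : ℕ) (hjK : j + 1 ≤ K), OneStepUpperTrivAt (h.dataT3c hc γ hγ hγ1 π) 𝔠.b₀ 𝔠.p₀ K j hjK) :
    RepAtHeights (h.dataT3c hc γ hγ hγ1 π) 𝔠.b₀ 𝔠.p₀ ε₀ :=
  h.repAtHeights_dataT3c_of_oneStepRows hc γ hγ hγ1 π ε₀ hε hhi ha₁ hlo h4
    (fun K j hjK => h.dataT3c_oneStepLowerTrivAt hc γ hγ hγ1 π K j hjK) hup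

end Assembly

end Summit.QuantumFields.YangMills.Theorems

end
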